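import Summits.QuantumFields.YangMills.Theorems.UnitScaleTiltAvgActionDefectFirstOrder
import Literature.MathematicalPhysics.QuantumFieldTheory.Balaban1983to89.T3LowerActionSplit
import Literature.MathematicalPhysics.QuantumFieldTheory.Balaban1983to89.T3OneStepAveragingPlaquettes
import Literature.MathematicalPhysics.QuantumFieldTheory.Balaban1983to89.B10Eq41TorusHistories
import Literature.MathematicalPhysics.QuantumFieldTheory.Balaban1983to89.MatrixNorms
import HarnessLib

/-!
# Route `UnitScaleTilt`, crux K1 child «MinimiserStabilityRegPr» (stmt-QuantumFields-19200): THE REGISTERED STUB `stub_avgActionDefect`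
# (located gap G-K1a-3b′, schema `T3LowerActionSplit.AvgActionDefectAt`) PROVED — `A(D_{K,K+1}U) ≤ L·A(U) + C₂(b² + ab + a³)L^{3(m+K+1)}`

Cell `ym3-torus` (HUMAN RULING D-0037, YM ladder rung R3), seat `ym3-torus-p1` gen 8 (UV side).  THE AVERAGING ACTION DEFECT of one
(0.4) block-averaging step ([Balaban1987RG1], inner operation `exp[mean log]` on `SU(2)`): for a fine configuration with plaquettes
`|U(∂q) − 1| < a ≤ c` the Wilson action of the block average is at most `L^{4−d}` times the fine action plus a CUBIC defect.

THE PROOF.  On `SU(2)`, `1 − Re tr W = ½|W − 1|²` exactly (tree `MatrixNorms.opDist1_sq_eq_of_mem_specialUnitaryGroup_two`).  By helper 3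
(`dist1_plaqHol_avgFun_le_mean_add`) each coarse plaquette satisfies `|Ū(∂p′) − 1| ≤ M_{p′} + R`, `M_{p′} = L^{−d}Σ_r D_{p′}(r)`, `D_{p′}(r)` the sum of
`|U(∂q) − 1|` over the `L²` plaquettes of the square at `blockSite p′₋ r`, `R = 435t²`, `t = (((d+2)L)²/4)·a`.  Jensen and Cauchy–Schwarz:
`½M² ≤ L^{2−d} Σ_r Σ_{q ⊂ sq(r)} ½|U(∂q) − 1|²`; summed over `p′` every fine plaquette occurs `L²` times (§1 `sum_coarse_squares`: the blocks
partition the fine sites, and translating the square's corner is a bijection of the fine plaquettes), so the quadratic part is EXACTLY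
`L^{4−d}·A(U)`; the cross and square terms give `#Plaq′·(L²a·R + ½R²) = O(a³)`.  For the `d = 3` family this is `A(D_{K,K+1}U) ≤ L·A(U) +
C₂·a³·L^{3(m+K+1)}` with `C₂ = 5·10⁷·L⁶`, `c = 1/(70L²)`; the gradient bound `b` of the schema is not needed.

* §1 counting: `shiftPlaq_injective`, `sum_plaq_shift`, `blockPlaq_bijective`, `sum_coarse_block`, **`sum_coarse_squares`**.
* §2 `one_sub_reTr_eq_half_dist1_sq_su2`.
* §3 **`wilsonAction4_avgFun_le`** (any `P`, level `j + 1 ≤ m + K`, `SU(2)`): `A(Ū) ≤ (L⁴/L^d)·A(U) + #Plaq′·(L²a·435t² + (435t²)²/2)`.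
* §4 **`avgActionDefectAt`**, **`stub_avgActionDefect`** (the registered signature verbatim): `∀ L, ∃ C₂ c, 0 ≤ C₂ ∧ 0 < c ∧ AvgActionDefectAt L C₂ c`.

References: T. Bałaban, CMP 109 (1987) 249–301 [Balaban1987RG1] ((0.4) p.253, (0.14) p.254); CMP 98 (1985) 17–51 [Balaban1985Averaging];
P. Federbush, CMP 110 (1987) 293–309 [Federbush1987PhaseCellIII] (Thm 4.3 (4.5), the printed twin for Federbush's averaging).
-/

noncomputable section

open scoped BigOperators Matrix.Norms.L2Operator

namespace Summit.QuantumFields.YangMills.Theorems.AvgActionDefect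

open Literature.MathematicalPhysics.QuantumFieldTheory.Balaban1983to89
open T4Continuum BlockAveraging AveragingRT B10Eq47AxialChi ExpMeanLog LatticeWordStokes BlockAveragingPlaquetteBound
open T3ContinuumYM3Torus T3LevelShift T3TiltDescent T3OneStepAveragingPlaquettes T3LowerActionSplit
open T3UnitLawDensityEML (ℰp)

/-! ## §1 Counting: every fine plaquette lies in exactly `L²` translated squares, the blocks partition the sites -/

section Counting

variable {P : Params} {j : ℕ}

/-- A unit shift is injective on the torus. [folklore] -/
private theorem shift_injective' (μ : Fin P.d) : Function.Injective (fun x : Site P j => x.shift μ) := by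
  intro x y h
  have h' := congrArg (fun z : Site P j => z.unshift μ) h
  simpa only [Site.unshift_shift] using h'

/-- An iterated shift is injective on the torus. [folklore] -/
theorem shiftN_injective (μ : Fin P.d) : ∀ n : ℕ, Function.Injective (fun x : Site P j => shiftN x μ n)
  | 0 => fun _ _ h => h
  | n + 1 => fun _ _ h => shiftN_injective μ n (shift_injective' μ h)

/-- Translating the corner of a plaquette by `s e_μ + t e_ν` (its own directions) is injective on the plaquettes of `T^{(j)}`. [folklore] -/
theorem shiftPlaq_injective (s t : ℕ) :
    Function.Injective (fun q : Plaq P j => (⟨shiftN (shiftN q.src q.ν t) q.μ s, q.μ, q.ν, q.hμν⟩ : Plaq P j)) := by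
  rintro ⟨x₁, μ₁, ν₁, h₁⟩ ⟨x₂, μ₂, ν₂, h₂⟩ h
  simp only [Plaq.mk.injEq] at h
  obtain ⟨hx, rfl, rfl⟩ := h
  have := shiftN_injective ν₁ t (shiftN_injective μ₁ s hx)
  subst this
  rfl

/-- **Translating the square's corner is a bijection of the fine plaquettes**: `Σ_q g(q + s e_μ + t e_ν) = Σ_q g(q)`. [folklore] -/
theorem sum_plaq_shift (g : Plaq P j → ℝ) (s t : ℕ) :
    ∑ q : Plaq P j, g ⟨shiftN (shiftN q.src q.ν t) q.μ s, q.μ, q.ν, q.hμν⟩ = ∑ q : Plaq P j, g q :=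
  (Finite.injective_iff_bijective.mp (shiftPlaq_injective (P := P) (j := j) s t)).sum_comp g

/-- **The blocks partition the fine sites, plaquette by plaquette** (standing range): `(p′, r) ↦ (blockSite p′₋ r; μ′, ν′)` is a
bijection from (coarse plaquettes) × (offsets) onto the fine plaquettes. [folklore] -/
theorem blockPlaq_bijective (hj : j + 1 ≤ P.m + P.K) :
    Function.Bijective (fun pr : Plaq P (j + 1) × (Fin P.d → Fin P.L) =>
      (⟨Site.blockSite pr.1.src pr.2, pr.1.μ, pr.1.ν, pr.1.hμν⟩ : Plaq P j)) := by
  constructor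
  · rintro ⟨⟨x₁, μ₁, ν₁, h₁⟩, r₁⟩ ⟨⟨x₂, μ₂, ν₂, h₂⟩, r₂⟩ h
    simp only [Plaq.mk.injEq] at h
    obtain ⟨hx, rfl, rfl⟩ := h
    obtain ⟨rfl, rfl⟩ := blockSite_inj hj hx
    rfl
  · rintro ⟨x, μ, ν, h⟩
    refine ⟨(⟨blockOf x, μ, ν, h⟩, Site.blockEquiv hj (blockOf x) ⟨x, rfl⟩), ?_⟩
    have hx : Site.blockSite (blockOf x) (Site.blockEquiv hj (blockOf x) ⟨x, rfl⟩) = x :=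
      congrArg Subtype.val ((Site.blockEquiv hj (blockOf x)).symm_apply_apply ⟨x, rfl⟩)
    simp only [hx]

/-- Hence `Σ_{p′} Σ_r g(blockSite p′₋ r; μ′, ν′) = Σ_q g(q)` (standing range). [folklore] -/
theorem sum_coarse_block (hj : j + 1 ≤ P.m + P.K) (g : Plaq P j → ℝ) :
    ∑ p : Plaq P (j + 1), ∑ r : Fin P.d → Fin P.L, g ⟨Site.blockSite p.src r, p.μ, p.ν, p.hμν⟩ = ∑ q : Plaq P j, g q := by
  rw [← (blockPlaq_bijective hj).sum_comp g, Fintype.sum_prod_type]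

/-- **EVERY FINE PLAQUETTE LIES IN EXACTLY `L²` OF THE TRANSLATED SQUARES** (standing range): summing `g` over the `L × L` plaquettes of the
square at `blockSite p′₋ r`, over all offsets `r` and all coarse plaquettes `p′`, gives `L² Σ_q g(q)`. [folklore] -/
theorem sum_coarse_squares (hj : j + 1 ≤ P.m + P.K) (g : Plaq P j → ℝ) :
    ∑ p : Plaq P (j + 1), ∑ r : Fin P.d → Fin P.L, ∑ t ∈ Finset.range P.L, ∑ s ∈ Finset.range P.L,
        g ⟨shiftN (shiftN (Site.blockSite p.src r) p.ν t) p.μ s, p.μ, p.ν, p.hμν⟩ =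
      (P.L : ℝ) ^ 2 * ∑ q : Plaq P j, g q := by
  set G : Plaq P (j + 1) → (Fin P.d → Fin P.L) → ℕ → ℕ → ℝ := fun p r t s =>
    g ⟨shiftN (shiftN (Site.blockSite p.src r) p.ν t) p.μ s, p.μ, p.ν, p.hμν⟩ with hG
  calc ∑ p : Plaq P (j + 1), ∑ r : Fin P.d → Fin P.L, ∑ t ∈ Finset.range P.L, ∑ s ∈ Finset.range P.L, G p r t s
      = ∑ p : Plaq P (j + 1), ∑ t ∈ Finset.range P.L, ∑ r : Fin P.d → Fin P.L, ∑ s ∈ Finset.range P.L, G p r t s :=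
        Finset.sum_congr rfl fun p _ => Finset.sum_comm
    _ = ∑ t ∈ Finset.range P.L, ∑ p : Plaq P (j + 1), ∑ r : Fin P.d → Fin P.L, ∑ s ∈ Finset.range P.L, G p r t s :=
        Finset.sum_comm
    _ = ∑ t ∈ Finset.range P.L, ∑ p : Plaq P (j + 1), ∑ s ∈ Finset.range P.L, ∑ r : Fin P.d → Fin P.L, G p r t s :=
        Finset.sum_congr rfl fun t _ => Finset.sum_congr rfl fun p _ => Finset.sum_comm
    _ = ∑ t ∈ Finset.range P.L, ∑ s ∈ Finset.range P.L, ∑ p : Plaq P (j + 1), ∑ r : Fin P.d → Fin P.L, G p r t s :=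
        Finset.sum_congr rfl fun t _ => Finset.sum_comm
    _ = ∑ t ∈ Finset.range P.L, ∑ s ∈ Finset.range P.L, ∑ q : Plaq P j, g q := by
        refine Finset.sum_congr rfl fun t _ => Finset.sum_congr rfl fun s _ => ?_
        rw [sum_coarse_block hj (fun q : Plaq P j => g ⟨shiftN (shiftN q.src q.ν t) q.μ s, q.μ, q.ν, q.hμν⟩), sum_plaq_shift g s t]
    _ = (P.L : ℝ) ^ 2 * ∑ q : Plaq P j, g q := by
        simp only [Finset.sum_const, Finset.card_range, nsmul_eq_mul]
        ring

end Counting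

/-! ## §2 The `SU(2)` action density is exactly half the squared distance to `1` -/

/-- **On `SU(2)`: `1 − Re tr W = ½|W − 1|²`** (normalised trace, operator norm) — [Balaban1987RG1] (0.14) as an operator-norm IDENTITY, special
to `SU(2)` (tree `MatrixNorms.opDist1_sq_eq_of_mem_specialUnitaryGroup_two`, Cayley–Hamilton). [cite: Balaban1987RG1, (0.14) p.254] -/
theorem one_sub_reTr_eq_half_dist1_sq_su2 (g : Matrix.specialUnitaryGroup (Fin 2) ℂ) : 1 - reTr g = 1 / 2 * dist1 g ^ 2 := by
  have h := MatrixNorms.opDist1_sq_eq_of_mem_specialUnitaryGroup_two g.2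
  have hd : dist1 g = UnitaryModel.opDist1 (g : Matrix (Fin 2) (Fin 2) ℂ) := rfl
  have hr : reTr g = UnitaryModel.nReTr (g : Matrix (Fin 2) (Fin 2) ℂ) := rfl
  rw [hd, hr, h]
  ring

/-! ## §3 The averaging action defect for one (0.4) step on any torus -/

section General

variable {P : Params} {j : ℕ}

/-- `δ₂ = 1/3`: the `SU(2)` radius of the printed `exp[mean log]` is `min(1/3, π/2) = 1/3`. [folklore] -/
theorem deltaSU_fin_two : deltaSU (Fin 2) = 1 / 3 := by
  rw [deltaSU, Fintype.card_fin, min_eq_left]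
  have := Real.pi_gt_three
  push_cast
  linarith

/-- **THE AVERAGING ACTION DEFECT, GENERAL FORM** (`SU(2)`, any `Params`, standing range `j + 1 ≤ m + K`): if `|U(∂q) − 1| < a` for all
fine plaquettes, `a ≥ 0`, and `t := (((d+2)L)²/4)·a ≤ 1/10`, then
`A(Ū) ≤ (L⁴/L^d)·A(U) + #Plaq(T^{(j+1)})·(L²a·435t² + (435t²)²/2)`
for the (0.4) block average `Ū = avgFun ℰ U` with the printed `exp[mean log]` — quadratic part exact (Jensen + Cauchy–Schwarz + §1), the
rest cubic in `a`. [cite: Balaban1987RG1, (0.4) p.253] -/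
theorem wilsonAction4_avgFun_le (hj : j + 1 ≤ P.m + P.K) {a : ℝ} (ha : 0 ≤ a)
    {U : GaugeField P j (Matrix.specialUnitaryGroup (Fin 2) ℂ)} (hU : PlaqSmall a U)
    (ht : ((((P.d + 2) * P.L : ℕ) : ℝ) ^ 2 / 4) * a ≤ 1 / 10) :
    wilsonAction4 (avgFun (expMeanLogSU (n := Fin 2)) U) ≤
      ((P.L : ℝ) ^ 2 * (P.L : ℝ) ^ 2 * ((P.L : ℝ) ^ P.d)⁻¹) * wilsonAction4 U +
        (Fintype.card (Plaq P (j + 1)) : ℝ) *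
          ((P.L : ℝ) ^ 2 * a * (435 * (((((P.d + 2) * P.L : ℕ) : ℝ) ^ 2 / 4) * a) ^ 2) +
            (435 * (((((P.d + 2) * P.L : ℕ) : ℝ) ^ 2 / 4) * a) ^ 2) ^ 2 / 2) := by
  set τ : ℝ := ((((P.d + 2) * P.L : ℕ) : ℝ) ^ 2 / 4) * a with hτ
  set R : ℝ := 435 * τ ^ 2 with hR
  have hR0 : 0 ≤ R := by positivity
  have hδ : τ < deltaSU (Fin 2) := by rw [deltaSU_fin_two]; linarith
  have hL : (0 : ℝ) < P.L := Nat.cast_pos.mpr P.L_pos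
  have hLd : (0 : ℝ) < (P.L : ℝ) ^ P.d := by positivity
  -- the square sums
  let D : Plaq P (j + 1) → (Fin P.d → Fin P.L) → ℝ := fun p r =>
    ∑ t ∈ Finset.range P.L, ∑ s ∈ Finset.range P.L,
      dist1 (GaugeField.plaqHol U ⟨shiftN (shiftN (Site.blockSite p.src r) p.ν t) p.μ s, p.μ, p.ν, p.hμν⟩)
  let D₂ : Plaq P (j + 1) → (Fin P.d → Fin P.L) → ℝ := fun p r =>
    ∑ t ∈ Finset.range P.L, ∑ s ∈ Finset.range P.L,
      dist1 (GaugeField.plaqHol U ⟨shiftN (shiftN (Site.blockSite p.src r) p.ν t) p.μ s, p.μ, p.ν, p.hμν⟩) ^ 2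
  -- per coarse plaquette
  have hper : ∀ p : Plaq P (j + 1), 1 / 2 * dist1 (GaugeField.plaqHol (avgFun (expMeanLogSU (n := Fin 2)) U) p) ^ 2 ≤
      (((P.L : ℝ) ^ P.d)⁻¹ * (P.L : ℝ) ^ 2 / 2) * (∑ r : Fin P.d → Fin P.L, D₂ p r) + ((P.L : ℝ) ^ 2 * a * R + R ^ 2 / 2) := by
    intro p
    have hM := dist1_plaqHol_avgFun_le_mean_add (n := Fin 2) hj ha hU ht hδ p
    set M : ℝ := ((P.L : ℝ) ^ P.d)⁻¹ * ∑ r : Fin P.d → Fin P.L, D p r with hMdef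
    have hM' : dist1 (GaugeField.plaqHol (avgFun (expMeanLogSU (n := Fin 2)) U) p) ≤ M + R := hM
    -- `0 ≤ M ≤ L² a`
    have hD0 : ∀ r, 0 ≤ D p r := fun r =>
      Finset.sum_nonneg fun _ _ => Finset.sum_nonneg fun _ _ => GaugeGroup.dist1_nonneg _
    have hDle : ∀ r, D p r ≤ (P.L : ℝ) ^ 2 * a := by
      intro r
      calc D p r ≤ ∑ _t ∈ Finset.range P.L, ∑ _s ∈ Finset.range P.L, a :=
            Finset.sum_le_sum fun _ _ => Finset.sum_le_sum fun _ _ => (hU _).le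
        _ = (P.L : ℝ) ^ 2 * a := by simp [Finset.sum_const, Finset.card_range]; ring
    have hM0 : 0 ≤ M := mul_nonneg (inv_nonneg.mpr hLd.le) (Finset.sum_nonneg fun r _ => hD0 r)
    have hMle : M ≤ (P.L : ℝ) ^ 2 * a := by
      calc M ≤ ((P.L : ℝ) ^ P.d)⁻¹ * ∑ _r : Fin P.d → Fin P.L, (P.L : ℝ) ^ 2 * a :=
            mul_le_mul_of_nonneg_left (Finset.sum_le_sum fun r _ => hDle r) (inv_nonneg.mpr hLd.le)
        _ = (P.L : ℝ) ^ 2 * a := by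
            rw [Finset.sum_const, Finset.card_univ, Fintype.card_fun, Fintype.card_fin, Fintype.card_fin, nsmul_eq_mul]
            push_cast
            field_simp
    -- Jensen and Cauchy–Schwarz: `M² ≤ (L^d)⁻¹ Σ_r D_r²`, `D_r² ≤ L² D₂_r`
    have hJ : M ^ 2 ≤ ((P.L : ℝ) ^ P.d)⁻¹ * ∑ r : Fin P.d → Fin P.L, D p r ^ 2 := by
      have h := sq_sum_le_card_mul_sum_sq (s := (Finset.univ : Finset (Fin P.d → Fin P.L))) (f := fun r => D p r)
      rw [Finset.card_univ, Fintype.card_fun, Fintype.card_fin, Fintype.card_fin] at h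
      push_cast at h
      rw [hMdef, mul_pow]
      calc (((P.L : ℝ) ^ P.d)⁻¹) ^ 2 * (∑ r, D p r) ^ 2 ≤ (((P.L : ℝ) ^ P.d)⁻¹) ^ 2 * ((P.L : ℝ) ^ P.d * ∑ r, D p r ^ 2) :=
            mul_le_mul_of_nonneg_left h (sq_nonneg _)
        _ = ((P.L : ℝ) ^ P.d)⁻¹ * ∑ r, D p r ^ 2 := by field_simp
    have hCS : ∀ r, D p r ^ 2 ≤ (P.L : ℝ) ^ 2 * D₂ p r := by
      intro r
      have h1 := sq_sum_le_card_mul_sum_sq (s := Finset.range P.L) (f := fun t => ∑ s ∈ Finset.range P.L,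
        dist1 (GaugeField.plaqHol U ⟨shiftN (shiftN (Site.blockSite p.src r) p.ν t) p.μ s, p.μ, p.ν, p.hμν⟩))
      have h2 : ∀ t ∈ Finset.range P.L, (∑ s ∈ Finset.range P.L,
          dist1 (GaugeField.plaqHol U ⟨shiftN (shiftN (Site.blockSite p.src r) p.ν t) p.μ s, p.μ, p.ν, p.hμν⟩)) ^ 2 ≤
          P.L * ∑ s ∈ Finset.range P.L,
            dist1 (GaugeField.plaqHol U ⟨shiftN (shiftN (Site.blockSite p.src r) p.ν t) p.μ s, p.μ, p.ν, p.hμν⟩) ^ 2 := by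
        intro t _
        have h := sq_sum_le_card_mul_sum_sq (s := Finset.range P.L) (f := fun s =>
          dist1 (GaugeField.plaqHol U ⟨shiftN (shiftN (Site.blockSite p.src r) p.ν t) p.μ s, p.μ, p.ν, p.hμν⟩))
        rwa [Finset.card_range] at h
      rw [Finset.card_range] at h1
      calc D p r ^ 2 ≤ P.L * ∑ t ∈ Finset.range P.L, (∑ s ∈ Finset.range P.L,
            dist1 (GaugeField.plaqHol U ⟨shiftN (shiftN (Site.blockSite p.src r) p.ν t) p.μ s, p.μ, p.ν, p.hμν⟩)) ^ 2 := h1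
        _ ≤ P.L * ∑ t ∈ Finset.range P.L, (P.L * ∑ s ∈ Finset.range P.L,
            dist1 (GaugeField.plaqHol U ⟨shiftN (shiftN (Site.blockSite p.src r) p.ν t) p.μ s, p.μ, p.ν, p.hμν⟩) ^ 2) :=
            mul_le_mul_of_nonneg_left (Finset.sum_le_sum h2) hL.le
        _ = (P.L : ℝ) ^ 2 * D₂ p r := by rw [← Finset.mul_sum]; ring
    have hJ2 : M ^ 2 ≤ ((P.L : ℝ) ^ P.d)⁻¹ * ((P.L : ℝ) ^ 2 * ∑ r : Fin P.d → Fin P.L, D₂ p r) := by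
      calc M ^ 2 ≤ ((P.L : ℝ) ^ P.d)⁻¹ * ∑ r : Fin P.d → Fin P.L, D p r ^ 2 := hJ
        _ ≤ ((P.L : ℝ) ^ P.d)⁻¹ * ∑ r : Fin P.d → Fin P.L, (P.L : ℝ) ^ 2 * D₂ p r :=
            mul_le_mul_of_nonneg_left (Finset.sum_le_sum fun r _ => hCS r) (inv_nonneg.mpr hLd.le)
        _ = ((P.L : ℝ) ^ P.d)⁻¹ * ((P.L : ℝ) ^ 2 * ∑ r : Fin P.d → Fin P.L, D₂ p r) := by rw [← Finset.mul_sum]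
    -- assemble the per-plaquette bound
    have h0 : 0 ≤ dist1 (GaugeField.plaqHol (avgFun (expMeanLogSU (n := Fin 2)) U) p) := GaugeGroup.dist1_nonneg _
    have hsq : dist1 (GaugeField.plaqHol (avgFun (expMeanLogSU (n := Fin 2)) U) p) ^ 2 ≤
        ((P.L : ℝ) ^ P.d)⁻¹ * ((P.L : ℝ) ^ 2 * ∑ r : Fin P.d → Fin P.L, D₂ p r) + (2 * ((P.L : ℝ) ^ 2 * a) * R + R ^ 2) := by
      calc dist1 (GaugeField.plaqHol (avgFun (expMeanLogSU (n := Fin 2)) U) p) ^ 2 ≤ (M + R) ^ 2 :=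
            pow_le_pow_left₀ h0 hM' 2
        _ = M ^ 2 + (2 * M * R + R ^ 2) := by ring
        _ ≤ M ^ 2 + (2 * ((P.L : ℝ) ^ 2 * a) * R + R ^ 2) := by nlinarith
        _ ≤ _ := add_le_add hJ2 le_rfl
    have := mul_le_mul_of_nonneg_left hsq (show (0 : ℝ) ≤ 1 / 2 by norm_num)
    refine this.trans (le_of_eq ?_)
    ring
  -- sum over the coarse plaquettes: every fine plaquette is counted `L²` times
  have hsum : ∑ p : Plaq P (j + 1), ∑ r : Fin P.d → Fin P.L, D₂ p r =
      (P.L : ℝ) ^ 2 * ∑ q : Plaq P j, dist1 (GaugeField.plaqHol U q) ^ 2 :=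
    sum_coarse_squares hj (fun q : Plaq P j => dist1 (GaugeField.plaqHol U q) ^ 2)
  have hA : wilsonAction4 U = 1 / 2 * ∑ q : Plaq P j, dist1 (GaugeField.plaqHol U q) ^ 2 := by
    unfold wilsonAction4 wilsonAction
    simp only [one_mul, one_sub_reTr_eq_half_dist1_sq_su2, Finset.mul_sum]
  have hAc : wilsonAction4 (avgFun (expMeanLogSU (n := Fin 2)) U) =
      ∑ p : Plaq P (j + 1), 1 / 2 * dist1 (GaugeField.plaqHol (avgFun (expMeanLogSU (n := Fin 2)) U) p) ^ 2 := by
    unfold wilsonAction4 wilsonAction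
    simp only [one_mul, one_sub_reTr_eq_half_dist1_sq_su2]
  rw [hAc, hA]
  calc ∑ p : Plaq P (j + 1), 1 / 2 * dist1 (GaugeField.plaqHol (avgFun (expMeanLogSU (n := Fin 2)) U) p) ^ 2
      ≤ ∑ p : Plaq P (j + 1), ((((P.L : ℝ) ^ P.d)⁻¹ * (P.L : ℝ) ^ 2 / 2) * (∑ r : Fin P.d → Fin P.L, D₂ p r) +
          ((P.L : ℝ) ^ 2 * a * R + R ^ 2 / 2)) := Finset.sum_le_sum fun p _ => hper p
    _ = (((P.L : ℝ) ^ P.d)⁻¹ * (P.L : ℝ) ^ 2 / 2) * ∑ p : Plaq P (j + 1), ∑ r : Fin P.d → Fin P.L, D₂ p r +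
          (Fintype.card (Plaq P (j + 1)) : ℝ) * ((P.L : ℝ) ^ 2 * a * R + R ^ 2 / 2) := by
        rw [Finset.sum_add_distrib, Finset.sum_const, Finset.card_univ, nsmul_eq_mul, ← Finset.mul_sum]
    _ = _ := by
        rw [hsum]
        ring

end General

/-! ## §4 The `d = 3` family: the schema `AvgActionDefectAt` and the registered stub -/

section T3

set_option maxHeartbeats 400000 in
/-- **G-K1a-3b′ FOR THE FAMILY, EXPLICIT CONSTANTS**: for every `L`, `AvgActionDefectAt L (5·10⁷·L⁶) (1/(70L²))` if `1 < L` (and trivially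
`AvgActionDefectAt L 0 1` if `L ≤ 1`, no member of the family having such a block size): one descent step `D_{K,K+1}` of the family is one
(0.4) averaging (`T3OneStepAveragingPlaquettes.descendTo_succ`) read through the level identification (`wilsonAction4_fieldShift`), and §3 with
`d = 3`, `#Plaq = 24L^{3(m+K)}`, `t = (25L²/4)·a ≤ 5/56 < 1/10`, `a⁴L⁸ ≤ a³L⁶/70`. [cite: Balaban1987RG1, (0.4) p.253] -/
theorem avgActionDefectAt (L : ℕ) (hL : 1 < L) :
    AvgActionDefectAt L (5 * 10 ^ 7 * (L : ℝ) ^ 6) (1 / (70 * (L : ℝ) ^ 2)) := by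
  intro F hFL K a b ha hac hb _ U hU _
  subst hFL
  have hL1 : (1 : ℝ) < F.L := by exact_mod_cast hL
  have hL0 : (0 : ℝ) < F.L := by linarith
  -- one descent step = one (0.4) averaging, same action
  have hW : wilsonAction4 (descendTo F ℰp K (K + 1) (Nat.le_succ K) U) =
      wilsonAction4 (avgFun (expMeanLogSU (n := Fin 2)) (P := F.P (K + 1)) (j := 0) U) := by
    rw [descendTo_succ]
    exact wilsonAction4_fieldShift _ _
  rw [hW]
  have hj : 0 + 1 ≤ (F.P (K + 1)).m + (F.P (K + 1)).K := by show 0 + 1 ≤ F.m + (K + 1); omega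
  -- the smallness threshold
  have hLa : (F.L : ℝ) ^ 2 * a ≤ 1 / 70 := by
    calc (F.L : ℝ) ^ 2 * a ≤ (F.L : ℝ) ^ 2 * (1 / (70 * (F.L : ℝ) ^ 2)) := mul_le_mul_of_nonneg_left hac (sq_nonneg _)
      _ = 1 / 70 := by field_simp
  have hτ : ((((3 + 2) * F.L : ℕ) : ℝ) ^ 2 / 4) * a = 25 / 4 * ((F.L : ℝ) ^ 2 * a) := by push_cast; ring
  have ht : ((((3 + 2) * F.L : ℕ) : ℝ) ^ 2 / 4) * a ≤ 1 / 10 := by rw [hτ]; linarith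
  have hmain := wilsonAction4_avgFun_le (P := F.P (K + 1)) hj ha hU ht
  -- the counts of the `d = 3` family
  have hcard : (Fintype.card (Plaq (F.P (K + 1)) (0 + 1)) : ℝ) = 24 * (F.L : ℝ) ^ (3 * (F.m + K)) := by
    rw [B10Eq41TorusHistories.card_plaq_three rfl, Site.card_site]
    show ((3 * (2 * F.L ^ (F.m + (K + 1) - (0 + 1))) ^ 3 : ℕ) : ℝ) = _
    rw [show F.m + (K + 1) - (0 + 1) = F.m + K by omega]
    push_cast
    ring
  have hlead : ((F.L : ℝ) ^ 2 * (F.L : ℝ) ^ 2 * ((F.L : ℝ) ^ 3)⁻¹) = F.L := by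
    field_simp
  change wilsonAction4 (avgFun (expMeanLogSU (n := Fin 2)) (P := F.P (K + 1)) (j := 0) U) ≤
      ((F.L : ℝ) ^ 2 * (F.L : ℝ) ^ 2 * ((F.L : ℝ) ^ 3)⁻¹) * wilsonAction4 U +
        (Fintype.card (Plaq (F.P (K + 1)) (0 + 1)) : ℝ) *
          ((F.L : ℝ) ^ 2 * a * (435 * (((((3 + 2) * F.L : ℕ) : ℝ) ^ 2 / 4) * a) ^ 2) +
            (435 * (((((3 + 2) * F.L : ℕ) : ℝ) ^ 2 / 4) * a) ^ 2) ^ 2 / 2) at hmain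
  rw [hcard, hlead, hτ] at hmain
  refine hmain.trans (add_le_add le_rfl ?_)
  -- the cubic defect
  have hA0 : 0 ≤ (F.L : ℝ) ^ 2 * a := by positivity
  have hpow : (F.L : ℝ) ^ (3 * (F.m + K)) ≤ (F.L : ℝ) ^ (3 * (F.m + (K + 1))) :=
    pow_le_pow_right₀ hL1.le (by omega)
  have hpow0 : 0 ≤ (F.L : ℝ) ^ (3 * (F.m + K)) := by positivity
  have hb2 : 0 ≤ b ^ 2 + a * b := by positivity
  -- per-plaquette defect `≤ 2079417·L⁶a³ = 2079417·(L²a)³`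
  have hdef : (F.L : ℝ) ^ 2 * a * (435 * (25 / 4 * ((F.L : ℝ) ^ 2 * a)) ^ 2) + (435 * (25 / 4 * ((F.L : ℝ) ^ 2 * a)) ^ 2) ^ 2 / 2 ≤
      2079417 * ((F.L : ℝ) ^ 2 * a) ^ 3 := by
    nlinarith [pow_nonneg hA0 3, pow_nonneg hA0 4, mul_le_mul_of_nonneg_left hLa (pow_nonneg hA0 3)]
  calc 24 * (F.L : ℝ) ^ (3 * (F.m + K)) *
        ((F.L : ℝ) ^ 2 * a * (435 * (25 / 4 * ((F.L : ℝ) ^ 2 * a)) ^ 2) + (435 * (25 / 4 * ((F.L : ℝ) ^ 2 * a)) ^ 2) ^ 2 / 2)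
      ≤ 24 * (F.L : ℝ) ^ (3 * (F.m + (K + 1))) * (2079417 * ((F.L : ℝ) ^ 2 * a) ^ 3) :=
        mul_le_mul (mul_le_mul_of_nonneg_left hpow (by norm_num)) hdef (by positivity) (by positivity)
    _ = 24 * 2079417 * (F.L : ℝ) ^ 6 * a ^ 3 * (F.L : ℝ) ^ (3 * (F.m + (K + 1))) := by ring
    _ ≤ 5 * 10 ^ 7 * (F.L : ℝ) ^ 6 * (b ^ 2 + a * b + a ^ 3) * (F.L : ℝ) ^ (3 * (F.m + (K + 1))) := by
        have h6 : 0 ≤ (F.L : ℝ) ^ 6 := by positivity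
        have h3 : 0 ≤ a ^ 3 := by positivity
        have hp : 0 ≤ (F.L : ℝ) ^ (3 * (F.m + (K + 1))) := by positivity
        nlinarith [mul_nonneg (mul_nonneg h6 hb2) hp, mul_nonneg (mul_nonneg h6 h3) hp]

/-- **THE REGISTERED STUB `stub_avgActionDefect` OF THE LAYER-4 v3b BIRTH OF «MinimiserStabilityRegPr» (stmt-QuantumFields-19200), PROVED**
(signature verbatim): for every `L` there are `C₂ ≥ 0` and `c > 0` with `AvgActionDefectAt L C₂ c` — `C₂ = 5·10⁷·L⁶`, `c = 1/(70L²)` for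
`L > 1`; `C₂ = 0`, `c = 1` for `L ≤ 1` (vacuous: every family has `1 < F.L`). [cite: Balaban1987RG1, (0.4) p.253] -/
theorem stub_avgActionDefect : ∀ (L : ℕ), ∃ C₂ c : ℝ, 0 ≤ C₂ ∧ 0 < c ∧ AvgActionDefectAt L C₂ c := by
  intro L
  by_cases hL : 1 < L
  · have hL0 : (0 : ℝ) < L := by exact_mod_cast (zero_lt_one.trans hL)
    exact ⟨5 * 10 ^ 7 * (L : ℝ) ^ 6, 1 / (70 * (L : ℝ) ^ 2), by positivity, by positivity, avgActionDefectAt L hL⟩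
  · exact ⟨0, 1, le_rfl, one_pos, fun F hFL => absurd (hFL ▸ F.hL.2) hL⟩

end T3

end Summit.QuantumFields.YangMills.Theorems.AvgActionDefect

end
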